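import Literature.Probability.Process.ItoIntegralConstruction
import Literature.Probability.Process.BrownianQuadraticSums
import HarnessLib

/-!
# Products of simple processes, sampled multipliers and refined grids

Bookkeeping for the bounded simple processes `Literature.SimpleProcess m 𝓕` of
`Literature.Probability.Process.ItoCalculus`, complementing `SimpleProcessAlgebra`
(refinement, differences) and `ItoIntegralConstruction` (dyadic sampling, `clamp`), as needed
for the Riemann-sum manipulations in the proof of Itô's formula:

* `SimpleProcess.mul H K` — the **product** of two simple processes on the common refinement
  (`toProcess_mul`), and the **associativity of elementary integrals**
  `(H K) · B = H · (K · B)` (`integral_mul`): integrating the product against `B` is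
  integrating `H` against the elementary integral `K · B` (Revuz–Yor, Ch. IV, Prop. (2.4) for
  elementary integrands);
* `SimpleProcess.sampleOn σ hσ u hu C` — an adapted integrand `σ` **sampled at the left end
  points of an arbitrary partition** `u` and clamped to `[-C, C]` (the general-grid version of
  `SimpleProcess.sample`), whose elementary integral against any process `Y` is the left-point
  Riemann–Stieltjes sum `∑ₖ clamp C (σ_{uₖ}) (Y_{r ∧ uₖ₊₁} - Y_{r ∧ uₖ})` (`integral_sampleOn`);
* `SimpleProcess.gridTimes H t n` — the partition of `H` refined by the uniform grid
  `t j / 2ⁿ`, `j ≤ 2ⁿ`, of `[0, t]` (`refine`-able: sorted, contains `H.times`), whose cells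
  inside `[0, t]` have length `≤ t / 2ⁿ` (`gridTimes_succ_sub_le`).

Everything is deterministic (pathwise) and generic in `(Ω, 𝓕)`.

## References

* D. Revuz, M. Yor, *Continuous Martingales and Brownian Motion* (3rd ed., 1999), Ch. IV,
  Prop. (2.4) (`H · (K · M) = (HK) · M`), Prop. (2.13) (Riemann sums).
* J.-F. Le Gall, *Brownian Motion, Martingales, and Stochastic Calculus* (2016), Prop. 5.9.
-/

open MeasureTheory Filter Finset
open scoped NNReal ENNReal Topology

noncomputable section

namespace Literature.Probability.Process

namespace SimpleProcess

variable {Ω : Type*} {m : MeasurableSpace Ω} {𝓕 : Filtration ℝ≥0 m}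

/-! ### Products of simple processes and associativity of elementary integrals -/

section Mul

variable (H K : SimpleProcess m 𝓕)

/-- **Product of two bounded simple processes**, as a bounded simple process on the common
refinement of their partitions: `(H K)ⱼ = Hⱼ' Kⱼ'` with `H', K'` the refinements of `H, K`.
Its step process is `H K` (`toProcess_mul`) and its elementary integrals satisfy the
associativity `(H K) · B = H · (K · B)` (`integral_mul`).
Revuz–Yor, *Continuous Martingales and Brownian Motion* (1999), Ch. IV, Prop. (2.4)
(for elementary integrands). [folklore] -/
def mul : SimpleProcess m 𝓕 where
  times := H.commonTimes K
  sorted := H.sortedLT_commonTimes K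
  value j ω :=
    (H.refine _ (H.sortedLT_commonTimes K) (H.subset_commonTimes_left K)).value j ω *
      (K.refine _ (H.sortedLT_commonTimes K) (H.subset_commonTimes_right K)).value j ω
  measurable j hj :=
    ((H.refine _ (H.sortedLT_commonTimes K) (H.subset_commonTimes_left K)).measurable j hj).mul
      ((K.refine _ (H.sortedLT_commonTimes K) (H.subset_commonTimes_right K)).measurable j hj)
  bounded := by
    obtain ⟨C, hC⟩ := (H.refine _ (H.sortedLT_commonTimes K) (H.subset_commonTimes_left K)).bounded
    obtain ⟨C', hC'⟩ :=
      (K.refine _ (H.sortedLT_commonTimes K) (H.subset_commonTimes_right K)).bounded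
    refine ⟨C * C', fun j ω ↦ ?_⟩
    rw [abs_mul]
    exact mul_le_mul (hC j ω) (hC' j ω) (abs_nonneg _) ((abs_nonneg _).trans (hC j ω))

/-- The step process of the product is the product of the step processes. [folklore] -/
theorem toProcess_mul (s : ℝ≥0) (ω : Ω) :
    (H.mul K).toProcess s ω = H.toProcess s ω * K.toProcess s ω := by
  rw [← H.toProcess_refine _ (H.sortedLT_commonTimes K) (H.subset_commonTimes_left K) s ω,
    ← K.toProcess_refine _ (H.sortedLT_commonTimes K) (H.subset_commonTimes_right K) s ω]
  set RH := H.refine _ (H.sortedLT_commonTimes K) (H.subset_commonTimes_left K) with hRH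
  set RK := K.refine _ (H.sortedLT_commonTimes K) (H.subset_commonTimes_right K) with hRK
  have h1 : ∀ i, (H.mul K).time i = RH.time i := fun i ↦ rfl
  have h2 : ∀ i, RK.time i = RH.time i := fun i ↦ rfl
  have h3 : (H.mul K).times.length = RH.times.length := rfl
  have h4 : RK.times.length = RH.times.length := rfl
  have h5 : ∀ i ω, (H.mul K).value i ω = RH.value i ω * RK.value i ω := fun i ω ↦ rfl
  unfold toProcess
  simp only [h1, h2, h3, h4, h5]
  by_cases h : ∃ j ∈ range (RH.times.length - 1), s ∈ Set.Ioc (RH.time j) (RH.time (j + 1))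
  · obtain ⟨j, hj, hsj⟩ := h
    have hj' : j + 1 < RH.times.length := by have := mem_range.1 hj; omega
    have hne : ∀ i ∈ range (RH.times.length - 1), i ≠ j →
        s ∉ Set.Ioc (RH.time i) (RH.time (i + 1)) := fun i hi hij ↦
      RH.not_mem_Ioc_of_mem_Ioc (by have := mem_range.1 hi; omega) hj' hij hsj
    rw [sum_eq_single j (fun i hi hij ↦ Set.indicator_of_notMem (hne i hi hij) _)
        (fun h ↦ (h hj).elim),
      sum_eq_single j (fun i hi hij ↦ Set.indicator_of_notMem (hne i hi hij) _)
        (fun h ↦ (h hj).elim),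
      sum_eq_single j (fun i hi hij ↦ Set.indicator_of_notMem (hne i hi hij) _)
        (fun h ↦ (h hj).elim),
      Set.indicator_of_mem hsj, Set.indicator_of_mem hsj, Set.indicator_of_mem hsj]
  · push Not at h
    rw [sum_eq_zero (fun i hi ↦ Set.indicator_of_notMem (h i hi) _),
      sum_eq_zero (fun i hi ↦ Set.indicator_of_notMem (h i hi) _), zero_mul]

/-- **Associativity of elementary integrals**: `(H K) · B = H · (K · B)` — the elementary integral
of the product against `B` is the elementary integral of `H` against the process `K · B`
(on the common refinement, the increment of `K · B` over a cell is `Kⱼ ΔⱼB`,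
`integral_min_succ_sub`).
Revuz–Yor, *Continuous Martingales and Brownian Motion* (1999), Ch. IV, Prop. (2.4)
(`H · (K · M) = (HK) · M`). [folklore] -/
theorem integral_mul (B : ℝ≥0 → Ω → ℝ) (r : ℝ≥0) (ω : Ω) :
    (H.mul K).integral B r ω = H.integral (K.integral B) r ω := by
  rw [← H.integral_refine _ (H.sortedLT_commonTimes K) (H.subset_commonTimes_left K)
    (K.integral B) r ω]
  set RH := H.refine _ (H.sortedLT_commonTimes K) (H.subset_commonTimes_left K) with hRH
  set RK := K.refine _ (H.sortedLT_commonTimes K) (H.subset_commonTimes_right K) with hRK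
  have hKB : K.integral B = RK.integral B := by
    ext s ω'
    exact (K.integral_refine _ (H.sortedLT_commonTimes K) (H.subset_commonTimes_right K) B s ω').symm
  rw [hKB]
  have h1 : ∀ i, (H.mul K).time i = RH.time i := fun i ↦ rfl
  have h2 : ∀ i, RK.time i = RH.time i := fun i ↦ rfl
  have h3 : (H.mul K).times.length = RH.times.length := rfl
  have h4 : RK.times.length = RH.times.length := rfl
  have h5 : ∀ i ω, (H.mul K).value i ω = RH.value i ω * RK.value i ω := fun i ω ↦ rfl
  unfold integral
  simp only [h1, h3, h5]
  refine sum_congr rfl fun j hj ↦ ?_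
  have hj' : j + 1 < RK.times.length := by have := mem_range.1 hj; rw [h4]; omega
  have hincr := RK.integral_min_succ_sub B hj' r ω
  simp only [SimpleProcess.integral] at hincr
  rw [h2, h2] at hincr
  rw [hincr]
  ring

end Mul

/-! ### Sampling an adapted integrand on an arbitrary partition -/

section SampleOn

variable (σ : ℝ≥0 → Ω → ℝ) (hσ : Adapted 𝓕 σ) (u : List ℝ≥0) (hu : u.SortedLT) (C : ℝ)

/-- **Sampling on a partition.** The bounded simple process with partition `u` whose value on
`(uₖ, uₖ₊₁]` is `σ_{uₖ}` clamped to `[-C, C]`: the elementary process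
`∑ₖ clamp C (σ_{uₖ}) 𝟙_{(uₖ, uₖ₊₁]}` of an adapted integrand `σ` read at the *left* end points
(the general-partition version of `SimpleProcess.sample`, which is the dyadic grid of `[0, n]`
with `C = n`). Its elementary integral against a process `Y` is the left-point Riemann–Stieltjes
sum `∑ₖ clamp C (σ_{uₖ}) (Y_{r ∧ uₖ₊₁} - Y_{r ∧ uₖ})` (`integral_sampleOn`).
Revuz–Yor, *Continuous Martingales and Brownian Motion* (1999), Ch. IV, Prop. (2.13);
Le Gall (2016), Prop. 5.9. [folklore] -/
def sampleOn : SimpleProcess m 𝓕 where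
  times := u
  sorted := hu
  value k ω := clamp C (σ (u.getD k 0) ω)
  measurable k hk := by
    have heq : u.get ⟨k, hk⟩ = u.getD k 0 := by
      rw [List.getD_eq_getElem?_getD, List.getElem?_eq_getElem hk, Option.getD_some]; rfl
    rw [heq]
    exact ((continuous_clamp C).measurable.comp (hσ _)).stronglyMeasurable
  bounded := ⟨|C|, fun k ω ↦ abs_clamp_le _ _⟩

/-- The partition of the sampled process. [folklore] -/
@[simp] theorem sampleOn_times : (sampleOn σ hσ u hu C).times = u := rfl

/-- The partition times of the sampled process. [folklore] -/
theorem sampleOn_time (k : ℕ) : (sampleOn σ hσ u hu C).time k = u.getD k 0 := rfl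

/-- The values of the sampled process: `σ` at the left end point, clamped. [folklore] -/
theorem sampleOn_value (k : ℕ) (ω : Ω) :
    (sampleOn σ hσ u hu C).value k ω = clamp C (σ ((sampleOn σ hσ u hu C).time k) ω) := rfl

/-- The values of the sampled process are bounded by `|C|`. [folklore] -/
theorem abs_sampleOn_value_le (k : ℕ) (ω : Ω) : |(sampleOn σ hσ u hu C).value k ω| ≤ |C| :=
  abs_clamp_le _ _

/-- **The elementary integral of a sampled process is a left-point Riemann–Stieltjes sum**:
`(σᵘ · Y)_r = ∑ₖ clamp C (σ_{uₖ}) (Y_{r ∧ uₖ₊₁} - Y_{r ∧ uₖ})`.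
Revuz–Yor, *Continuous Martingales and Brownian Motion* (1999), Ch. IV, Prop. (2.13). [folklore] -/
theorem integral_sampleOn (Y : ℝ≥0 → Ω → ℝ) (r : ℝ≥0) (ω : Ω) :
    (sampleOn σ hσ u hu C).integral Y r ω = ∑ k ∈ range (u.length - 1),
      clamp C (σ ((sampleOn σ hσ u hu C).time k) ω) *
        (Y (min r ((sampleOn σ hσ u hu C).time (k + 1))) ω -
          Y (min r ((sampleOn σ hσ u hu C).time k)) ω) := rfl

/-- On the cell `(uₖ, uₖ₊₁]` the sampled step process is `clamp C (σ_{uₖ})`. [folklore] -/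
theorem toProcess_sampleOn {k : ℕ} (hk : k + 1 < u.length) {s : ℝ≥0}
    (hs : s ∈ Set.Ioc ((sampleOn σ hσ u hu C).time k) ((sampleOn σ hσ u hu C).time (k + 1)))
    (ω : Ω) :
    (sampleOn σ hσ u hu C).toProcess s ω = clamp C (σ ((sampleOn σ hσ u hu C).time k) ω) :=
  (sampleOn σ hσ u hu C).toProcess_eq_value_of_mem_Ioc hk hs ω

end SampleOn

/-! ### Refining a partition by the uniform grid of `[0, t]` -/

section Grid

variable (H : SimpleProcess m 𝓕) (t : ℝ≥0) (n : ℕ)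

/-- The partition of `H` refined by the uniform grid `t j / 2ⁿ`, `j ≤ 2ⁿ`, of `[0, t]`: the
sorted list of all these times (duplicates removed).
Revuz–Yor, *Continuous Martingales and Brownian Motion* (1999), Ch. IV, §2 ("subdivisions
including the `tᵢ`'s"). [folklore] -/
def gridTimes : List ℝ≥0 :=
  ((H.times ++ (List.range (2 ^ n + 1)).map fun j : ℕ ↦ t * (j : ℝ≥0) / 2 ^ n).toFinset).sort

/-- The refined partition is strictly sorted. [folklore] -/
theorem sortedLT_gridTimes : (H.gridTimes t n).SortedLT := Finset.sortedLT_sort _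

/-- Membership in the refined partition. [folklore] -/
theorem mem_gridTimes_iff {x : ℝ≥0} :
    x ∈ H.gridTimes t n ↔ x ∈ H.times ∨ ∃ j : ℕ, j < 2 ^ n + 1 ∧ t * (j : ℝ≥0) / 2 ^ n = x := by
  simp only [gridTimes, Finset.mem_sort, List.mem_toFinset, List.mem_append, List.mem_map,
    List.mem_range]

/-- The refined partition contains the partition of `H`. [folklore] -/
theorem subset_gridTimes : H.times ⊆ H.gridTimes t n := fun _ hx ↦
  (H.mem_gridTimes_iff t n).2 (Or.inl hx)

/-- The refined partition contains the uniform grid points. [folklore] -/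
theorem uniformGrid_mem_gridTimes {j : ℕ} (hj : j ≤ 2 ^ n) :
    t * (j : ℝ≥0) / 2 ^ n ∈ H.gridTimes t n :=
  (H.mem_gridTimes_iff t n).2 (Or.inr ⟨j, Nat.lt_succ_of_le hj, rfl⟩)

/-- The refined partition contains `0`. [folklore] -/
theorem zero_mem_gridTimes : (0 : ℝ≥0) ∈ H.gridTimes t n := by
  simpa using H.uniformGrid_mem_gridTimes t n (Nat.zero_le _)

/-- The refined partition contains `t`. [folklore] -/
theorem self_mem_gridTimes : t ∈ H.gridTimes t n := by
  have := H.uniformGrid_mem_gridTimes t n (le_refl (2 ^ n))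
  rwa [Nat.cast_pow, Nat.cast_ofNat, mul_div_assoc, div_self (pow_ne_zero n two_ne_zero),
    mul_one] at this

/-- **`H` refined by the uniform grid of `[0, t]`**: the simple process with partition
`gridTimes H t n` and the same step process and elementary integrals as `H`
(`SimpleProcess.refine`). [folklore] -/
def gridRefine : SimpleProcess m 𝓕 :=
  H.refine (H.gridTimes t n) (H.sortedLT_gridTimes t n) (H.subset_gridTimes t n)

/-- The partition of the grid refinement. [folklore] -/
@[simp] theorem gridRefine_times : (H.gridRefine t n).times = H.gridTimes t n := rfl

/-- The grid refinement has the same step process. [folklore] -/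
theorem toProcess_gridRefine (s : ℝ≥0) (ω : Ω) : (H.gridRefine t n).toProcess s ω = H.toProcess s ω :=
  H.toProcess_refine _ _ _ s ω

/-- The grid refinement has the same elementary integrals. [folklore] -/
theorem integral_gridRefine (B : ℝ≥0 → Ω → ℝ) (r : ℝ≥0) (ω : Ω) :
    (H.gridRefine t n).integral B r ω = H.integral B r ω :=
  H.integral_refine _ _ _ B r ω

/-- The values of the grid refinement obey the bound of `H` (or `0`). [folklore] -/
theorem abs_gridRefine_value_le {C : ℝ} (hC : ∀ i ω, |H.value i ω| ≤ C) (j : ℕ) (ω : Ω) :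
    |(H.gridRefine t n).value j ω| ≤ max C 0 :=
  H.abs_toProcess_le hC _ ω

/-- The grid refinement has at least the two partition times `0` and `t`… more precisely its
partition is nonempty. [folklore] -/
theorem length_gridRefine_pos : 0 < (H.gridRefine t n).times.length :=
  List.length_pos_of_mem (H.zero_mem_gridTimes t n)

/-- The first partition time of the grid refinement is `0`. [folklore] -/
theorem gridRefine_time_zero : (H.gridRefine t n).time 0 = 0 := by
  obtain ⟨p, hp, hp0⟩ := (H.gridRefine t n).exists_time_eq_of_mem (H.zero_mem_gridTimes t n)
  exact le_antisymm (((H.gridRefine t n).time_mono (Nat.zero_le p) hp).trans_eq hp0) zero_le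

/-- `t` is a partition time of the grid refinement. [folklore] -/
theorem exists_gridRefine_time_eq :
    ∃ p, p < (H.gridRefine t n).times.length ∧ (H.gridRefine t n).time p = t :=
  (H.gridRefine t n).exists_time_eq_of_mem (H.self_mem_gridTimes t n)

/-- The last partition time of the grid refinement is `≥ t`. [folklore] -/
theorem le_gridRefine_time_length_sub_one :
    t ≤ (H.gridRefine t n).time ((H.gridRefine t n).times.length - 1) := by
  obtain ⟨p, hp, hpt⟩ := H.exists_gridRefine_time_eq t n
  exact hpt.symm.le.trans ((H.gridRefine t n).time_mono (by omega) (by omega))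

/-- **Mesh of the grid refinement inside `[0, t]`**: every capped cell
`t ∧ uⱼ₊₁ - t ∧ uⱼ` of the grid refinement has length `≤ t / 2ⁿ` (the next uniform grid point
after `uⱼ < t` is a partition time). [folklore] -/
theorem gridRefine_cappedCell_le {j : ℕ} (hj : j + 1 < (H.gridRefine t n).times.length) :
    (((min t ((H.gridRefine t n).time (j + 1))) : ℝ≥0) : ℝ) -
        (min t ((H.gridRefine t n).time j) : ℝ≥0) ≤ (t : ℝ) / 2 ^ n := by
  set R := H.gridRefine t n with hR
  have h2n : (0 : ℝ) < 2 ^ n := pow_pos two_pos n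
  rcases le_or_gt t (R.time j) with hjt | hjt
  · -- degenerate capped cell
    rw [min_eq_left hjt, min_eq_left (hjt.trans (R.time_mono (Nat.le_succ j) hj)), sub_self]
    positivity
  · -- `uⱼ < t`: locate `uⱼ` in a uniform cell `[r_k, r_{k+1})`
    have ht0 : (0 : ℝ) < t := lt_of_le_of_lt (NNReal.coe_nonneg _) (NNReal.coe_lt_coe.2 hjt)
    set a : ℝ := (R.time j : ℝ) with ha
    have ha0 : 0 ≤ a := NNReal.coe_nonneg _
    set k : ℕ := ⌊a * 2 ^ n / t⌋₊ with hk
    have hx0 : 0 ≤ a * 2 ^ n / t := by positivity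
    have hk1 : (k : ℝ) ≤ a * 2 ^ n / t := Nat.floor_le hx0
    have hk2 : a * 2 ^ n / t < k + 1 := Nat.lt_floor_add_one _
    have hklt : k < 2 ^ n := by
      rw [hk, Nat.floor_lt hx0, div_lt_iff₀ ht0]
      push_cast
      have : a < t := NNReal.coe_lt_coe.2 hjt
      nlinarith
    -- the uniform point `r_{k+1}` is a partition time, strictly after `uⱼ`, hence `≥ uⱼ₊₁`
    have hmem : t * ((k + 1 : ℕ) : ℝ≥0) / 2 ^ n ∈ R.times :=
      H.uniformGrid_mem_gridTimes t n (Nat.succ_le_of_lt hklt)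
    obtain ⟨q, hq, hqr⟩ := R.exists_time_eq_of_mem hmem
    have hgt : R.time j < R.time q := by
      rw [hqr, ← NNReal.coe_lt_coe]
      push_cast
      rw [← ha, lt_div_iff₀ h2n]
      rw [div_lt_iff₀ ht0] at hk2
      nlinarith
    have hjq : j + 1 ≤ q := Nat.succ_le_of_lt ((R.time_lt_time_iff (by omega) hq).1 hgt)
    have hle : R.time (j + 1) ≤ R.time q := R.time_mono hjq hq
    -- conclude
    have hrk : (t : ℝ) * k / 2 ^ n ≤ a := by
      rw [div_le_iff₀ h2n]
      rw [le_div_iff₀ ht0] at hk1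
      nlinarith
    calc (((min t (R.time (j + 1))) : ℝ≥0) : ℝ) - (min t (R.time j) : ℝ≥0)
        ≤ (R.time q : ℝ) - a := by
          rw [min_eq_right hjt.le]
          gcongr
          exact NNReal.coe_le_coe.2 ((min_le_right _ _).trans hle)
      _ = (t : ℝ) * (k + 1) / 2 ^ n - a := by rw [hqr]; push_cast; ring
      _ ≤ (t : ℝ) / 2 ^ n := by
          have : (t : ℝ) * (k + 1) / 2 ^ n = (t : ℝ) * k / 2 ^ n + (t : ℝ) / 2 ^ n := by ring
          rw [this]; linarith

end Grid

end SimpleProcess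

end Literature.Probability.Process
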